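import Summits.Parity.GeneralizedHardyLittlewood.Theorems.PrimeLevelFamEdgeIdeaDeltasPeterssonLayersSplit
import HarnessLib

/-!
# Route `PrimeLevelFamEdge` — TYPED IDEA DELTAS, deck 21b: K-L17-2 «PETERSSON LAYERS» v3 continued — §5 the heart's own
# split RUNG (`c = q`) + UPPER LAYERS (glue proved), §5b ERRATUM OF RECORD + P-E7-1: FAR LAYERS as an explicit piece, the
# IDENTIFICATION `TailNearFar`, the WEIL CUT `ρ_W = 4Δ' − 3/2`, and the SIX-piece glue `MomentsBeyondDiagonal_of_sixSplitWeil`.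
# LANDING NOTE (typer ls-idea-typ-1 gen 3): seat ls-idea-lens-17 `Split_PeterssonLayers.v3.lean` sha16 90790e3a81ab6eae
# l.338–508 VERBATIM up to the namespace relabel (see deck 21a).  HONESTY: glue and bookkeeping only; no piece of K_A
# (stmt-Parity-20007), no moment asymptotic and no exceptional-zero theorem (no Landau–Siegel / Siegel-zero exclusion, no
# Theorem 1–2 of arXiv:2211.02515, no repaired Margin232) is proved here; typed ≠ proved.
-/

noncomputable section

open scoped MatrixGroups Real
open CongruenceSubgroup Complex Finset Polynomial MeasureTheory
open Literature.NumberTheory.EllipticCurves.ModularForms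
open Literature.NumberTheory.LFunctions

namespace Summit.Parity.GeneralizedHardyLittlewood.Theorems.PrimeLevelFamEdgeIdeaDeltas.PeterssonLayers

open Summit.Parity.GeneralizedHardyLittlewood.Theses.PrimeLevelFamEdge
open Summit.Parity.GeneralizedHardyLittlewood.Theorems.PrimeLevelFamEdgeIdeaDeltas.PairsSplit
  (FirstMomentBeyond SubFirst subFirst_of_momentsBeyondDiagonal)

/-! ## §5. The heart's own split: RUNG (`c = q`) + UPPER LAYERS (`c = 2q, 3q, …`) — glue proved -/

/-- **GENERIC TWO-PIECE GLUE inside a level family:** if `H = R + U` eventually (for `q ≥ 64`, on the window), then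
`SubOf R → SubOf U → SubOf H` (`t_H := t_R + t_U`). -/
theorem subOf_of_add (H R U : LevelFamily)
    (hsplit : ∀ (q : ℕ) [NeZero q] (P Q : ℝ[X]) (Δ' : ℝ), 1 < Δ' → 64 ≤ q →
      H q P Q Δ' = R q P Q Δ' + U q P Q Δ') :
    SubOf R → SubOf U → SubOf H := by
  rintro ⟨Δ₁, h₁, tr, H₁⟩ ⟨Δ₂, h₂, tu, H₂⟩
  refine ⟨min Δ₁ Δ₂, lt_min h₁ h₂, fun Δ' P Q ↦ tr Δ' P Q + tu Δ' P Q, ?_⟩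
  intro P Q hP hQ Δ hlo hhi
  obtain ⟨C₁, q₁, HH₁⟩ := H₁ P Q hP hQ Δ hlo (hhi.trans (min_le_left _ _))
  obtain ⟨C₂, q₂, HH₂⟩ := H₂ P Q hP hQ Δ hlo (hhi.trans (min_le_right _ _))
  refine ⟨C₁ + C₂, max (max q₁ q₂) 64, fun q _ hq hq₀ hM ↦ ?_⟩
  have h64 : 64 ≤ q := le_trans (le_max_right _ _) hq₀
  have hr := HH₁ q hq (le_trans (le_max_left _ _) (le_trans (le_max_left _ _) hq₀)) hM
  have hu := HH₂ q hq (le_trans (le_max_right _ _) (le_trans (le_max_left _ _) hq₀)) hM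
  rw [hsplit q P Q Δ hlo h64]
  set N₂ : ℂ := (2 * riemannZeta 2 ^ 2 *
      ((KMV2000.qhat q / (Δ ^ 2 * Real.log (KMV2000.qhat q) ^ 2) : ℝ) : ℂ)) with hN₂
  have e : R q P Q Δ + U q P Q Δ - N₂ * ((tr Δ P Q + tu Δ P Q : ℝ) : ℂ) =
      (R q P Q Δ - N₂ * ((tr Δ P Q : ℝ) : ℂ)) + (U q P Q Δ - N₂ * ((tu Δ P Q : ℝ) : ℂ)) := by
    push_cast
    ring
  rw [e]
  calc ‖(R q P Q Δ - N₂ * ((tr Δ P Q : ℝ) : ℂ)) + (U q P Q Δ - N₂ * ((tu Δ P Q : ℝ) : ℂ))‖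
      ≤ ‖R q P Q Δ - N₂ * ((tr Δ P Q : ℝ) : ℂ)‖ + ‖U q P Q Δ - N₂ * ((tu Δ P Q : ℝ) : ℂ)‖ := norm_add_le _ _
    _ ≤ C₁ * KMV2000.qhat q * (Real.log (KMV2000.qhat q))⁻¹ ^ 3 +
          C₂ * KMV2000.qhat q * (Real.log (KMV2000.qhat q))⁻¹ ^ 3 := add_le_add hr hu
    _ = (C₁ + C₂) * KMV2000.qhat q * (Real.log (KMV2000.qhat q))⁻¹ ^ 3 := by ring

/-- For `q ≥ 64` and `ρ(Δ') ≥ 0` at least one layer is kept (`q̂^{ρ} ≥ 1`). -/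
theorem one_le_layerCount {q : ℕ} [NeZero q] (hq : 64 ≤ q) {ρ : ℝ → ℝ} {Δ' : ℝ} (hρ : 0 ≤ ρ Δ') :
    1 ≤ layerCount q ρ Δ' := by
  unfold layerCount
  have h1 : (1 : ℝ) ≤ KMV2000.qhat q ^ ρ Δ' := Real.one_le_rpow (one_lt_qhat hq).le hρ
  exact Nat.le_floor (by exact_mod_cast h1)

/-- **GLUE for the heart (proved): `SubRung → SubUpper ρ → SubHeart ρ`** for every cut with `ρ ≥ 0` beyond the
diagonal. Hence the FOUR-piece split `SubFirst → SubDiag → SubRung → SubUpper ρ → SubTail ρ → K_A`. -/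
theorem subHeart_of_rung_upper (ρ : ℝ → ℝ) (hρ : ∀ Δ' : ℝ, 1 < Δ' → 0 ≤ ρ Δ') :
    SubRung → SubUpper ρ → SubHeart ρ :=
  subOf_of_add (fun q _ P Q Δ' ↦ heart q ρ P Q Δ') (fun q _ P Q Δ' ↦ rung q P Q Δ')
    (fun q _ P Q Δ' ↦ upper q ρ P Q Δ')
    (fun q _ P Q Δ' hΔ' hq ↦ heart_eq_rung_add_upper q ρ P Q Δ' (one_le_layerCount hq (hρ Δ' hΔ')))

/-- The v1 four-piece split at `ρ⋆`: `SubFirst → SubDiag → SubRung → SubUpper ρ⋆ → SubTail ρ⋆ → K_A` (of record since §5b: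
`MomentsBeyondDiagonal_of_sixSplitWeil`). -/
theorem MomentsBeyondDiagonal_of_fourSplitStar :
    SubFirst → SubDiag → SubRung → SubUpper rhoStar → SubTailStar → KA :=
  fun h₁ h₂ h₃ h₄ h₅ ↦ MomentsBeyondDiagonal_of_layerSplitStar h₁ h₂
    (subHeart_of_rung_upper rhoStar (fun Δ' hΔ' ↦ by unfold rhoStar; linarith) h₃ h₄) h₅

/-! ## §5b. ERRATUM OF RECORD (gen 2, 2026-08-28T08:10Z) and P-E7-1 (REF-E b7) ADOPTED: the FAR LAYERS as an
explicit piece, the IDENTIFICATION as its own statement, the WEIL CUT `ρ_W`, and the SIX-piece glue (kernel-checked).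

THE COUNT (fixed-pair technology; `Δ' > 1`; layer block `r ≤ c < 2r` of the second display at `M = q̂^{Δ'}`; target
`q̂ (log q̂)⁻³`): Weil's bound with `|J₁(x)| ≤ x/2` gives block total `≍ q̂^{2Δ'+ε} r^{−1/2}`; Poisson in `n₁, n₂` plus
divisor counting of the resonances `a₁a₂ ≡ m₁m₂ (mod rq)` (the METHOD of KMV Lemma 3.3 / [VdK2]) gives `≍ q̂^{2Δ'−1+ε}`,
FLAT in `r`. So the deficit against the target is `q̂^{2(Δ'−1)}` flat for `q̂^{Δ'−1} ≤ r ≤ q̂²`, then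
`q̂^{2Δ'−1} r^{−1/2}`, and reaches `1` only at `r = q̂^{4Δ'−2}`: NO cut `ρ < 4Δ' − 2` has a tail closable by fixed-pair
methods (the `1/r` of `J₁` is already inside both counts). CONSEQUENCES: (i) the gloss «tail of record = layer-scaled
image of KMV's printed regime, Lemma-3.3 method expected» attached to `ρ⋆ = 3(Δ'−1)` is RETRACTED — `SubTailStar`'s far
layers sit inside the flat-deficit range exactly like the heart's small-argument layers; (ii) the PROVABLE tail
instance is the WEIL CUT `ρ_W(Δ') = 4Δ' − 3/2` (far block total `≤ q̂^{3/4+ε}`), typed below; (iii) BN-7a's deficit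
`(M/q̂)² = q̂^{2(Δ'−1)}` is spread log-uniformly over ALL Petersson moduli `rq`, `r ≤ q̂²` — the wall is not
concentrated at `c = q`. The glue of §4–§5 is `∀ρ`, so no proved statement changes; the instance of record does.
P-E7-1: REF-E's kernel lemma `subTail_iff_KA` (modulo the explicit pieces the difference-defined tail IS K_A) ⇒ the
tail is now TWO items: the identification `TailNearFar ρ` (L, typing) and the explicit far layers `SubFar ρ` (M at
`ρ_W`), glued by `subTail_of_ident_far` (perturbation + negation, proved). -/

section Far

variable (q : ℕ) [NeZero q]

/-- **FAR(ρ) = the layers beyond the heart, `⌊q̂^{ρ(Δ')}⌋ < r ≤ q⁸`** (explicit; cusp-form-free). The layers `r > q⁸`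
total `O(q̂^{2Δ'+ε} q^{−4})` by Weil and belong to the identification error. -/
def farLayers (ρ : ℝ → ℝ) (P Q : ℝ[X]) (Δ' : ℝ) : ℂ :=
  ∑ r ∈ Icc (layerCount q ρ Δ' + 1) (q ^ 8), layer q P Q Δ' r

end Far

/-- **`T` IS NEAR `F`:** eventually, on some window beyond the diagonal, `‖T − F‖ ≤ C q̂ (log q̂)⁻³` — the second
display's own error size; `HasShape` is stable under such perturbations (`subOf_of_near`). -/
def Near (T F : LevelFamily) : Prop :=
  ∃ Δ : ℝ, 1 < Δ ∧ ∀ P Q : ℝ[X], KMV2000.Admissible P → KMV2000.IsEvenOrOdd Q → ∀ Δ' : ℝ, 1 < Δ' → Δ' ≤ Δ →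
    ∃ C : ℝ, ∃ q₀ : ℕ, ∀ (q : ℕ) [NeZero q], q.Prime → q₀ ≤ q →
      (∀ n : ℕ, (n : ℝ) ≠ KMV2000.qhat q ^ Δ') →
        ‖T q P Q Δ' - F q P Q Δ'‖ ≤ C * KMV2000.qhat q * (Real.log (KMV2000.qhat q))⁻¹ ^ 3

/-- **Sub_far(ρ) (size M at the Weil cut `ρ_W`; P-E7-1's `stub_farLayers`):** the explicit far layers have the
second-display shape (expected `t = 0`: Weil's bound for `S(a,b;rq)`, `|J₁(x)| ≤ x/2`, absolute convergence). At a cut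
`ρ < 4Δ'−2` this is NOT a fixed-pair statement (see THE COUNT). -/
def SubFar (ρ : ℝ → ℝ) : Prop := SubOf (fun q _ P Q Δ' ↦ farLayers q ρ P Q Δ')

/-- **Ident(ρ) (size L, TYPING; P-E7-1's `stub_ident`):** the difference-defined tail IS minus the far layers up to the
second display's error, `TAIL(ρ) = −FAR(ρ) + E`, `‖E‖ ≤ C q̂ (log q̂)⁻³`. Inputs, none of them typed in the tree yet
(typing want W-L17-2): the two-order exact AFE (KMV (21)–(22)) for `derivLambda` on `newforms0 q 2`; Hecke's recursion
(KMV (10)) for `GL2Family.heckeLambda`; Petersson's formula WITH its Kloosterman series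
(`KowalskiMichel2000.kowalskiMichel2000_peterssonFormula`) over the eigenbasis `GL2Family.harmonicSum` uses; reality of
`λ_f` and `Λ^{(j)}(f,½)`; Weil for the layers `r > q⁸` and for the AFE truncation `n > q²`. -/
def TailNearFar (ρ : ℝ → ℝ) : Prop :=
  Near (fun q _ P Q Δ' ↦ tail q ρ P Q Δ') (fun q _ P Q Δ' ↦ -farLayers q ρ P Q Δ')

/-- **PERTURBATION GLUE (proved): `Near T F → SubOf F → SubOf T`** (same main-term functional). -/
theorem subOf_of_near (T F : LevelFamily) : Near T F → SubOf F → SubOf T := by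
  rintro ⟨Δ₁, h₁, H₁⟩ ⟨Δ₂, h₂, t, H₂⟩
  refine ⟨min Δ₁ Δ₂, lt_min h₁ h₂, t, ?_⟩
  intro P Q hP hQ Δ hlo hhi
  obtain ⟨C₁, q₁, HH₁⟩ := H₁ P Q hP hQ Δ hlo (hhi.trans (min_le_left _ _))
  obtain ⟨C₂, q₂, HH₂⟩ := H₂ P Q hP hQ Δ hlo (hhi.trans (min_le_right _ _))
  refine ⟨C₁ + C₂, max q₁ q₂, fun q _ hq hq₀ hM ↦ ?_⟩
  have hn := HH₁ q hq (le_trans (le_max_left _ _) hq₀) hM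
  have hf := HH₂ q hq (le_trans (le_max_right _ _) hq₀) hM
  set N₂ : ℂ := (2 * riemannZeta 2 ^ 2 *
      ((KMV2000.qhat q / (Δ ^ 2 * Real.log (KMV2000.qhat q) ^ 2) : ℝ) : ℂ)) with hN₂
  have e : T q P Q Δ - N₂ * ((t Δ P Q : ℝ) : ℂ) =
      (T q P Q Δ - F q P Q Δ) + (F q P Q Δ - N₂ * ((t Δ P Q : ℝ) : ℂ)) := by ring
  rw [e]
  calc ‖(T q P Q Δ - F q P Q Δ) + (F q P Q Δ - N₂ * ((t Δ P Q : ℝ) : ℂ))‖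
      ≤ ‖T q P Q Δ - F q P Q Δ‖ + ‖F q P Q Δ - N₂ * ((t Δ P Q : ℝ) : ℂ)‖ := norm_add_le _ _
    _ ≤ C₁ * KMV2000.qhat q * (Real.log (KMV2000.qhat q))⁻¹ ^ 3 +
          C₂ * KMV2000.qhat q * (Real.log (KMV2000.qhat q))⁻¹ ^ 3 := add_le_add hn hf
    _ = (C₁ + C₂) * KMV2000.qhat q * (Real.log (KMV2000.qhat q))⁻¹ ^ 3 := by ring

/-- **NEGATION GLUE (proved): `SubOf F → SubOf (−F)`** (`t ↦ −t`). -/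
theorem subOf_neg (F : LevelFamily) : SubOf F → SubOf (fun q _ P Q Δ' ↦ -F q P Q Δ') := by
  rintro ⟨Δ, hΔ, t, H⟩
  refine ⟨Δ, hΔ, fun Δ' P Q ↦ -t Δ' P Q, ?_⟩
  intro P Q hP hQ Δ' hlo hhi
  obtain ⟨C, q₀, HH⟩ := H P Q hP hQ Δ' hlo hhi
  refine ⟨C, q₀, fun q _ hq hq₀ hM ↦ ?_⟩
  have h := HH q hq hq₀ hM
  set N₂ : ℂ := (2 * riemannZeta 2 ^ 2 *
      ((KMV2000.qhat q / (Δ' ^ 2 * Real.log (KMV2000.qhat q) ^ 2) : ℝ) : ℂ)) with hN₂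
  have e : -F q P Q Δ' - N₂ * (((-t Δ' P Q : ℝ)) : ℂ) = -(F q P Q Δ' - N₂ * ((t Δ' P Q : ℝ) : ℂ)) := by
    push_cast
    ring
  show ‖-F q P Q Δ' - N₂ * (((-t Δ' P Q : ℝ)) : ℂ)‖ ≤ C * KMV2000.qhat q * (Real.log (KMV2000.qhat q))⁻¹ ^ 3
  rw [e, norm_neg]
  exact h

/-- **TAIL GLUE (proved): `TailNearFar ρ → SubFar ρ → SubTail ρ`** — the two P-E7-1 items recompose the tail piece. -/
theorem subTail_of_ident_far (ρ : ℝ → ℝ) : TailNearFar ρ → SubFar ρ → SubTail ρ :=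
  fun hI hF ↦ subOf_of_near _ _ hI (subOf_neg _ hF)

/-- **The WEIL CUT `ρ_W(Δ') = 4Δ' − 3/2`:** the far layers `r > q̂^{4Δ'−3/2}` total `≤ q̂^{3/4+ε}` by Weil's bound —
the provable tail instance (erratum of record); everything below it is the wall at flat deficit `q̂^{2(Δ'−1)}`. -/
def rhoWeil : ℝ → ℝ := fun Δ' ↦ 4 * Δ' - 3 / 2

/-- The v1 cut lies strictly below the Weil cut (for `Δ' ≥ 0`). -/
theorem rhoStar_lt_rhoWeil (Δ' : ℝ) (h : 0 ≤ Δ') : rhoStar Δ' < rhoWeil Δ' := by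
  unfold rhoStar rhoWeil
  linarith

/-- The Weil cut is positive beyond the diagonal. -/
theorem rhoWeil_pos (Δ' : ℝ) (h : 1 < Δ') : 0 < rhoWeil Δ' := by
  unfold rhoWeil
  linarith

/-- **SIX-PIECE GLUE at every cut `ρ ≥ 0` beyond the diagonal (proved):**
`SubFirst → SubDiag → SubRung → SubUpper ρ → TailNearFar ρ → SubFar ρ → K_A`. -/
theorem MomentsBeyondDiagonal_of_sixSplit (ρ : ℝ → ℝ) (hρ : ∀ Δ' : ℝ, 1 < Δ' → 0 ≤ ρ Δ') :
    SubFirst → SubDiag → SubRung → SubUpper ρ → TailNearFar ρ → SubFar ρ → KA :=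
  fun h₁ h₂ h₃ h₄ h₅ h₆ ↦ MomentsBeyondDiagonal_of_layerSplit ρ h₁ h₂
    (subHeart_of_rung_upper ρ hρ h₃ h₄) (subTail_of_ident_far ρ h₅ h₆)

/-- **THE SIX-PIECE SPLIT OF RECORD at the Weil cut (proved; P-E7-1 adopted):**
`SubFirst → SubDiag → SubRung → SubUpper ρ_W → TailNearFar ρ_W → SubFar ρ_W → K_A`. -/
theorem MomentsBeyondDiagonal_of_sixSplitWeil :
    SubFirst → SubDiag → SubRung → SubUpper rhoWeil → TailNearFar rhoWeil → SubFar rhoWeil →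
      KA :=
  MomentsBeyondDiagonal_of_sixSplit rhoWeil (fun Δ' hΔ' ↦ (rhoWeil_pos Δ' hΔ').le)

end Summit.Parity.GeneralizedHardyLittlewood.Theorems.PrimeLevelFamEdgeIdeaDeltas.PeterssonLayers

end
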